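import Mathlib
import Summits.Ventures.PercRepro2.Defs
import Summits.Ventures.PercRepro2.Graph
import Summits.Ventures.PercRepro2.OneColourSwitch
import Summits.Ventures.PercRepro2.RegionHubSign
import Summits.Ventures.PercRepro2.SideSwitch
import Summits.Ventures.PercRepro2.SideSwitchComps
import Summits.Ventures.PercRepro2.TermSwitchDefs
import Summits.Ventures.PercRepro2.TermSwitchFibre
import Summits.Ventures.PercRepro2.TermSwitchCompsFibre
import Summits.Ventures.PercRepro2.TermSwitchMono
import Summits.Ventures.PercRepro2.TermSwitchM9
import Summits.Ventures.PercRepro2.M9NoPocketDefs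
import Summits.Ventures.PercRepro2.M9YSliceDefs

/-!
# The unreached half of the `Y`-slice, read in `G − d` (blind cell PercRepro2, p3 g26,
2026-08-28; `proofs/P3-YSLICE.md` §3(O), part 1)

A point of the unreached half `ySliceO` (every non-loop edge at `d` is `Y`, `d` in no world of
`{r, s}`) is a `Sep ∧ DZero` colouring of the looped graph `G − d` (`endsD`) in which no
neighbour of `d` lies in the `Y`-world (`NoNbK`): the worlds of `G` and `G − d` agree
(`K2_endsD_of_not_mem`, `M2_endsD_of_not_mem`), `d ∉ K₂` is exactly `NoNbK`
(`not_mem_K2_iff_noNbK`), `σ_rs` is that of `G − d` (`sigma_rs_endsD_of_unreached`), and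
`p ~_W q` is the same in `G − d` since the `W`-paths avoid `d` (`conn_endsD_iff_of_star_closed`).
So `ySliceO` is the sum over the `DZero` colourings of `G − d` of the kernel
`oker = 1_{StarY ∧ NoNbK} · (1[p ~_Y q in G] − 1[p ~_W q in G − d]) · σ_rs(G − d)`
(`ySliceO_eq_sum_oker`).  Along the fibres of `G − d` the kernel's predicate reads «the
representative is in the slice, no neighbour of `d` is a terminal, and every component holding a
neighbour of `d` is switched» (`oker_assignC`).  Own work; std axioms.
-/

namespace Summit.Ventures.PercRepro2

namespace NoPocket

open Finset Classical RegionHub OneColourSwitch SideSwitch TermSwitch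

variable {V : Type*} {E : Type*}
variable [Fintype V] [DecidableEq V] [Fintype E] [DecidableEq E]

section Translate

variable {ends : E → Sym2 V}

omit [Fintype V] [DecidableEq V] [Fintype E] [DecidableEq E] in
/-- A connection from `r` that never reaches `d` is a connection of `G − d`. -/
lemma conn_endsD_of_not_reach {ω : Config E} {d r x : V} (hd : ¬ Conn ends ω r d)
    (h : Conn ends ω r x) : Conn (endsD ends d) ω r x := by
  refine mem_of_conn_of_closed (S := {z | Conn (endsD ends d) ω r z}) ?_ (conn_refl _ _ _) h
  intro a ha b hab
  obtain ⟨hne, e, he, hends⟩ := openGraph_adj.1 hab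
  have hbd : b ≠ d := by
    rintro rfl
    exact hd (conn_trans (conn_of_conn_endsD ha) (conn_of_openAdj ⟨e, he, hends⟩))
  have had : a ≠ d := by
    rintro rfl
    exact hd (conn_of_conn_endsD ha)
  refine conn_trans ha (conn_of_openAdj ⟨e, he, ?_⟩)
  rw [endsD_of_notMem (notMem_of_ends_ne hends had hbd), hends]

omit [Fintype V] [DecidableEq V] [Fintype E] [DecidableEq E] in
/-- For `d` outside the `Y`-world, the `Y`-world of `{r, s}` is that of `G − d`. -/
lemma K2_endsD_of_not_mem {ω : Config E} {r s d : V} (hd : d ∉ K2 ends r s ω) :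
    K2 ends r s ω = K2 (endsD ends d) r s ω := by
  ext x
  rw [mem_K2_iff, mem_K2_iff]
  constructor
  · rintro (h | h)
    · exact Or.inl (conn_endsD_of_not_reach (fun h' => hd (mem_K2_iff.2 (Or.inl h'))) h)
    · exact Or.inr (conn_endsD_of_not_reach (fun h' => hd (mem_K2_iff.2 (Or.inr h'))) h)
  · rintro (h | h)
    · exact Or.inl (conn_of_conn_endsD h)
    · exact Or.inr (conn_of_conn_endsD h)

omit [Fintype V] [DecidableEq V] [Fintype E] [DecidableEq E] in
/-- For `d` outside the `W`-world, the `W`-world of `{r, s}` is that of `G − d`. -/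
lemma M2_endsD_of_not_mem {ω : Config E} {r s d : V} (hd : d ∉ M2 ends r s ω) :
    M2 ends r s ω = M2 (endsD ends d) r s ω := by
  rw [← K2_compl, ← K2_compl]
  exact K2_endsD_of_not_mem (by rw [K2_compl]; exact hd)

omit [Fintype V] [DecidableEq V] [Fintype E] [DecidableEq E] in
/-- If every non-loop edge at `d` is closed, connections between vertices other than `d` are
those of `G − d`. -/
lemma conn_endsD_iff_of_star_closed {ω : Config E} {d : V}
    (h : ∀ e, d ∈ ends e → ¬ (ends e).IsDiag → ω e = false) {a b : V} (ha : a ≠ d) :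
    Conn ends ω a b ↔ Conn (endsD ends d) ω a b := by
  constructor
  · intro hc
    refine mem_of_conn_of_closed (S := {z | Conn (endsD ends d) ω a z}) ?_ (conn_refl _ _ _) hc
    intro x hx y hxy
    obtain ⟨hne, e, he, hends⟩ := openGraph_adj.1 hxy
    have hxd : x ≠ d := by
      rintro rfl
      have hmem : x ∈ ends e := by rw [hends]; exact Sym2.mem_mk_left _ _
      have hnd : ¬ (ends e).IsDiag := by
        rw [hends]; exact fun hd' => hne (Sym2.mk_isDiag_iff.1 hd')
      rw [h e hmem hnd] at he
      exact Bool.false_ne_true he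
    have hyd : y ≠ d := by
      rintro rfl
      have hmem : y ∈ ends e := by rw [hends]; exact Sym2.mem_mk_right _ _
      have hnd : ¬ (ends e).IsDiag := by
        rw [hends]; exact fun hd' => hne (Sym2.mk_isDiag_iff.1 hd')
      rw [h e hmem hnd] at he
      exact Bool.false_ne_true he
    refine conn_trans hx (conn_of_openAdj ⟨e, he, ?_⟩)
    rw [endsD_of_notMem (notMem_of_ends_ne hends hxd hyd), hends]
  · exact conn_of_conn_endsD

variable (ends)

omit [Fintype V] [DecidableEq V] [Fintype E] [DecidableEq E] in
/-- No neighbour of `d` lies in the `Y`-world of `{r, s}` in `G − d`. -/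
def NoNbK (r s d : V) (ω : Config E) : Prop :=
  ∀ e y, ends e = s(d, y) → y ∉ K2 (endsD ends d) r s ω

/-- The kernel of the unreached half, read in `G − d`:
`1_{StarY ∧ NoNbK} · (1[p ~_Y q in G] − 1[p ~_W q in G − d]) · σ_rs(G − d)`. -/
noncomputable def oker (p q r s d : V) (ω : Config E) : ℤ :=
  if StarY ends d ω ∧ NoNbK ends r s d ω then
    ((if Conn ends ω p q then (1 : ℤ) else 0) -
      (if Conn (endsD ends d) (OneColourSwitch.compl ω) p q then 1 else 0)) *
      sigma (endsD ends d) ω r s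
  else 0

variable {ends}

omit [Fintype V] [DecidableEq V] [Fintype E] [DecidableEq E] in
/-- `d` is in no `Y`-world of `G − d`. -/
lemma not_mem_K2_endsD' {r s d : V} (hr : d ≠ r) (hs : d ≠ s) (ω : Config E) :
    d ∉ K2 (endsD ends d) r s ω :=
  not_mem_K2_endsD hr hs ω

omit [Fintype V] [DecidableEq V] [Fintype E] [DecidableEq E] in
/-- On the slice, «`d` unreached in `Y`» is «no neighbour of `d` in the `Y`-world of `G − d`». -/
lemma not_mem_K2_iff_noNbK {r s d : V} (hr : d ≠ r) (hs : d ≠ s) {ω : Config E}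
    (hY : StarY ends d ω) : d ∉ K2 ends r s ω ↔ NoNbK ends r s d ω := by
  constructor
  · intro hd e y hey hy
    by_cases hyd : y = d
    · subst hyd
      exact not_mem_K2_endsD' hr hs ω hy
    · have hde : d ∈ ends e := by rw [hey]; exact Sym2.mem_mk_left _ _
      have hnd : ¬ (ends e).IsDiag := by
        rw [hey, Sym2.mk_isDiag_iff]; exact fun h => hyd h.symm
      have hyd' : Conn ends ω y d := conn_of_openAdj ⟨e, hY e hde hnd, by rw [hey, Sym2.eq_swap]⟩
      apply hd
      rcases mem_K2_iff.1 hy with h | h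
      · exact mem_K2_iff.2 (Or.inl (conn_trans (conn_of_conn_endsD h) hyd'))
      · exact mem_K2_iff.2 (Or.inr (conn_trans (conn_of_conn_endsD h) hyd'))
  · intro hN hd
    have hclosed : ∀ a ∈ K2 (endsD ends d) r s ω, ∀ b, (openGraph ends ω).Adj a b →
        b ∈ K2 (endsD ends d) r s ω := by
      intro a ha b hab
      obtain ⟨hne, e, he, hends⟩ := openGraph_adj.1 hab
      have had : a ≠ d := by
        rintro rfl
        exact not_mem_K2_endsD' hr hs ω ha
      by_cases hbd : b = d
      · subst hbd
        exact (hN e a (by rw [hends, Sym2.eq_swap]) ha).elim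
      · have hD : Conn (endsD ends d) ω a b := by
          refine conn_of_openAdj ⟨e, he, ?_⟩
          rw [endsD_of_notMem (notMem_of_ends_ne hends had hbd), hends]
        rcases mem_K2_iff.1 ha with h | h
        · exact mem_K2_iff.2 (Or.inl (conn_trans h hD))
        · exact mem_K2_iff.2 (Or.inr (conn_trans h hD))
    have hr' : r ∈ K2 (endsD ends d) r s ω := mem_K2_iff.2 (Or.inl (conn_refl _ _ _))
    have hs' : s ∈ K2 (endsD ends d) r s ω := mem_K2_iff.2 (Or.inr (conn_refl _ _ _))
    rcases mem_K2_iff.1 hd with h | h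
    · exact not_mem_K2_endsD' hr hs ω (mem_of_conn_of_closed hclosed hr' h)
    · exact not_mem_K2_endsD' hr hs ω (mem_of_conn_of_closed hclosed hs' h)

omit [Fintype V] [DecidableEq V] [Fintype E] [DecidableEq E] in
/-- For `d` in no world, the `rs`-sign is that of `G − d`. -/
lemma sigma_rs_endsD_of_unreached {r s d : V} {ω : Config E} (hK : d ∉ K2 ends r s ω)
    (hM : d ∉ M2 ends r s ω) : sigma ends ω r s = sigma (endsD ends d) ω r s := by
  have hY : Conn ends ω r s ↔ Conn (endsD ends d) ω r s :=
    ⟨conn_endsD_of_not_reach (fun h => hK (mem_K2_iff.2 (Or.inl h))), conn_of_conn_endsD⟩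
  have hW : Conn ends (OneColourSwitch.compl ω) r s ↔
      Conn (endsD ends d) (OneColourSwitch.compl ω) r s :=
    ⟨conn_endsD_of_not_reach (fun h => hM (mem_M2_iff.2 (Or.inl h))), conn_of_conn_endsD⟩
  unfold sigma
  rw [if_congr hY rfl rfl, if_congr hW rfl rfl]

omit [Fintype V] [DecidableEq V] [Fintype E] [DecidableEq E] in
/-- On the slice the `W`-connection `p ~_W q` is that of `G − d`. -/
lemma conn_pq_compl_endsD_of_starY {p q d : V} {ω : Config E} (hY : StarY ends d ω)
    (hp : p ≠ d) : Conn ends (OneColourSwitch.compl ω) p q ↔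
      Conn (endsD ends d) (OneColourSwitch.compl ω) p q :=
  conn_endsD_iff_of_star_closed (fun e hde hnd => by
    simp only [OneColourSwitch.compl, hY e hde hnd]; rfl) hp

omit [Fintype V] [DecidableEq V] [Fintype E] [DecidableEq E] in
/-- The `Y`-world of the terminal set `{r, s}` is `K₂` (any graph). -/
lemma KH_pair' (ends : E → Sym2 V) (r s : V) (ω : Config E) :
    KH ends ({r, s} : Set V) ω = K2 ends r s ω := rfl

omit [Fintype V] [DecidableEq V] [Fintype E] [DecidableEq E] in
/-- The `W`-world of the terminal set `{r, s}` is `M₂` (any graph). -/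
lemma MH_pair' (ends : E → Sym2 V) (r s : V) (ω : Config E) :
    MH ends ({r, s} : Set V) ω = M2 ends r s ω := rfl

omit [Fintype V] [DecidableEq V] [Fintype E] [DecidableEq E] in
/-- **The slice condition of the unreached half, in `G − d`.** -/
lemma unreached_slice_iff {p q r s d : V} (hr : d ≠ r) (hs : d ≠ s) {ω : Config E} :
    (sep2 ends p q r s ω ∧ DOne ends r s d ω ∧ StarY ends d ω ∧ d ∉ K2 ends r s ω) ↔
      ((sepH (endsD ends d) p q ({r, s} : Set V) ω ∧ DZeroH (endsD ends d) ({r, s} : Set V) ω) ∧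
        (StarY ends d ω ∧ NoNbK ends r s d ω)) := by
  constructor
  · rintro ⟨h1, h2, h3, h4⟩
    have hM : d ∉ M2 ends r s ω := not_mem_M2_of_starY hr hs h3
    have eK := K2_endsD_of_not_mem h4
    have eM := M2_endsD_of_not_mem hM
    refine ⟨⟨?_, ?_⟩, h3, (not_mem_K2_iff_noNbK hr hs h3).1 h4⟩
    · have := sepH_pair_of_sep2 h1
      rw [sepH, KH_pair', MH_pair'] at this ⊢
      rwa [← eK, ← eM]
    · intro x hxH hxK hxM
      rw [KH_pair', ← eK] at hxK
      rw [MH_pair', ← eM] at hxM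
      have hxr : x ≠ r := fun h => hxH (by rw [h]; simp)
      have hxs : x ≠ s := fun h => hxH (by rw [h]; simp)
      by_cases hxd : x = d
      · subst hxd; exact h4 hxK
      · exact h2 x hxr hxs hxd hxK hxM
  · rintro ⟨⟨h1, h2⟩, h3, h4⟩
    have hK : d ∉ K2 ends r s ω := (not_mem_K2_iff_noNbK hr hs h3).2 h4
    have hM : d ∉ M2 ends r s ω := not_mem_M2_of_starY hr hs h3
    have eK := K2_endsD_of_not_mem hK
    have eM := M2_endsD_of_not_mem hM
    refine ⟨?_, ?_, h3, hK⟩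
    · have h1' : sepH ends p q ({r, s} : Set V) ω := by
        rw [sepH, KH_pair', MH_pair'] at h1 ⊢
        rwa [eK, eM]
      exact sep2_of_sepH (by simp) (by simp) h1'
    · intro x hxr hxs _ hxK hxM
      have hxH : x ∉ ({r, s} : Set V) := by
        simp only [Set.mem_insert_iff, Set.mem_singleton_iff, not_or]
        exact ⟨hxr, hxs⟩
      refine h2 x hxH ?_ ?_
      · rw [KH_pair', ← eK]; exact hxK
      · rw [MH_pair', ← eM]; exact hxM

/-- **The unreached half as a `DZero` sum of `G − d`.** -/
lemma ySliceO_eq_sum_oker {p q r s d : V} (hr : d ≠ r) (hs : d ≠ s) (hp : p ≠ d) :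
    ySliceO ends p q r s d =
      ∑ ω ∈ DZeroSetH (endsD ends d) p q ({r, s} : Set V), oker ends p q r s d ω := by
  have hset : DZeroSetH (endsD ends d) p q ({r, s} : Set V) = univ.filter
      (fun ω => sepH (endsD ends d) p q ({r, s} : Set V) ω ∧
        DZeroH (endsD ends d) ({r, s} : Set V) ω) := by
    ext ω; simp [DZeroSetH, SepSetH]
  rw [hset, Finset.sum_filter, ySliceO]
  refine Finset.sum_congr rfl (fun ω _ => ?_)
  unfold oker
  by_cases hc : sep2 ends p q r s ω ∧ DOne ends r s d ω ∧ StarY ends d ω ∧ d ∉ K2 ends r s ω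
  · have hc' := (unreached_slice_iff hr hs).1 hc
    rw [if_pos hc, if_pos hc'.1, if_pos hc'.2]
    have hM : d ∉ M2 ends r s ω := not_mem_M2_of_starY hr hs hc.2.2.1
    rw [sigma_rs_endsD_of_unreached hc.2.2.2 hM]
    congr 1
    unfold sigma
    simp only [conn_pq_compl_endsD_of_starY (q := q) hc.2.2.1 hp]
    by_cases h1 : Conn ends ω p q <;>
      by_cases h2 : Conn (endsD ends d) (OneColourSwitch.compl ω) p q <;> simp [h1, h2]
  · rw [if_neg hc]
    by_cases h1 : sepH (endsD ends d) p q ({r, s} : Set V) ω ∧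
        DZeroH (endsD ends d) ({r, s} : Set V) ω
    · rw [if_pos h1, if_neg (fun h2 => hc ((unreached_slice_iff hr hs).2 ⟨h1, h2⟩))]
    · rw [if_neg h1]

end Translate

end NoPocket

end Summit.Ventures.PercRepro2
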